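import Summits.KontsevichZagierPeriods.Zeta5Search.Zudilin2002CasoratianRates
import HarnessLib

/-!
# ζ(5) search — Zudilin 2002: the SIGNS (3) `ℓₙ > 0`, `ℓ̃ₙ < 0` from the two identifications (cell `pub-zeta5`, TYPER)

HONEST FRAMING: systematic search; no irrationality claim unless certified.

Zudilin's Theorem 1 (Mat. Zametki 72 (2002); tree `Literature.…Zudilin2002`) has three parts: the
signs (3) `ℓₙ = qₙζ(5) - pₙ > 0`, `ℓ̃ₙ = qₙζ(3) - p̃ₙ < 0` (`n ≥ 1`) — the named fact
`Zudilin2002.theorem1_signs`, used as a HYPOTHESIS by `SymmetricFamilyMarginQ.forms_ne_zero /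
scaled_forms_rate / margin_lt`; the rates (4)–(5) — `theorem1_rates`, reduced to the two
identifications `pₙ/qₙ → ζ(5)`, `p̃ₙ/qₙ → ζ(3)` in `Zudilin2002Decay.theorem1_rates_of_tendsto`; and
those identifications themselves (the hypergeometric content, Sect. 2 of the source).

This file reduces the SIGNS to the same two identifications:

* `TailSqueeze.sign_lim_sub` — generic: if the steps `dₖ = r_{k+1} - r_k` of a convergent sequence
  contract geometrically with ratio `θ < 1/2` from `n₀` on, then for `n ≥ n₀` the error `L - rₙ` has
  the SIGN of the first step `dₙ` (indeed `σ(L - rₙ) ≥ ((1-2θ)/(1-θ))|dₙ| > 0` when `σdₙ = |dₙ|`);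
* `signed_step_pos` — the steps of `pₙ/qₙ` alternate: `(-1)^{n+1}(p_{n+1}/q_{n+1} - pₙ/qₙ) > 0`
  (`n ≥ 2`; Casoratian `Zₙ > 0` and `qₙq_{n+1} < 0`); `signed_step_tilde_pos` — the steps of `p̃ₙ/qₙ`
  alternate the other way: `(-1)^n(p̃_{n+1}/q_{n+1} - p̃ₙ/qₙ) > 0` (`n ≥ 3`);
* `ell_pos_of_tendsto` — **if `pₙ/qₙ → L` then `qₙL - pₙ > 0` for every `n ≥ 1`**;
  `ellTilde_neg_of_tendsto` — **if `p̃ₙ/qₙ → L'` then `qₙL' - p̃ₙ < 0` for every `n ≥ 1`**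
  (`n ≥ 2`, resp. `n ≥ 3`, by the tail sign with `θ = 1045/796²`; `n = 1`, resp. `n = 1, 2`, by the
  exact first steps `199/163968`, `-31/95648`, `128801/2306649917880` dominating the certified tails);
* `theorem1_signs_of_tendsto` — **`(pₙ/qₙ → ζ(5)) → (p̃ₙ/qₙ → ζ(3)) → Zudilin2002.theorem1_signs`**.

With `Zudilin2002Decay.theorem1_rates_of_tendsto` the WHOLE of the cited Theorem 1 ((3), (4), (5))
is now a consequence of the two limit identifications alone. Everything is PROVED (0 sorry).
-/

noncomputable section

open Filter Topology Finset
open Literature.NumberTheory.Irrationality.Zudilin2002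
open Literature.NumberTheory.Transcendental

namespace Summit.KontsevichZagierPeriods.Zeta5Search

namespace TailSqueeze

variable (r : ℕ → ℝ) {θ : ℝ} (n₀ : ℕ) {L : ℝ}

/-- **Sign of the tail.** Steps contracting with ratio `θ < 1/2` from `n₀` on, `rₙ → L`, `n ≥ n₀`,
`|σ| = 1` and `σ·(r_{n+1} - rₙ) > 0`: then `σ·(L - rₙ) ≥ ((1-2θ)/(1-θ))·|r_{n+1} - rₙ| > 0` — the
error has the sign of the first step. -/
theorem sign_lim_sub (hθ0 : 0 ≤ θ) (hθ : θ < 1 / 2) (hlim : Tendsto r atTop (𝓝 L))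
    (hcontr : ∀ k, n₀ ≤ k → |r (k + 2) - r (k + 1)| ≤ θ * |r (k + 1) - r k|)
    (n : ℕ) (hn : n₀ ≤ n) {σ : ℝ} (hσ : |σ| = 1) (hd : 0 < σ * (r (n + 1) - r n)) :
    0 < σ * (L - r n) := by
  have hθ1 : θ < 1 := by linarith
  have h1θ : 0 < 1 - θ := by linarith
  have htail := abs_lim_sub_le r n₀ hθ0 hθ1 hlim hcontr (n + 1) (by omega)
  have hc := hcontr n hn
  have hdn : |r (n + 1) - r n| = σ * (r (n + 1) - r n) := by
    have e : |σ * (r (n + 1) - r n)| = |r (n + 1) - r n| := by rw [abs_mul, hσ, one_mul]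
    rw [← e, abs_of_pos hd]
  have h1 : -|L - r (n + 1)| ≤ σ * (L - r (n + 1)) := by
    have e : |σ * (L - r (n + 1))| = |L - r (n + 1)| := by rw [abs_mul, hσ, one_mul]
    rw [← e]; exact neg_abs_le _
  have h2 : |L - r (n + 1)| ≤ θ * |r (n + 1) - r n| / (1 - θ) :=
    htail.trans (div_le_div_of_nonneg_right hc h1θ.le)
  have h3 : θ * |r (n + 1) - r n| / (1 - θ) < |r (n + 1) - r n| := by
    rw [div_lt_iff₀ h1θ]
    have hdpos : 0 < |r (n + 1) - r n| := by rw [hdn]; exact hd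
    nlinarith
  have e : σ * (L - r n) = σ * (r (n + 1) - r n) + σ * (L - r (n + 1)) := by ring
  rw [e]
  linarith

end TailSqueeze

namespace Zudilin2002Growth

/-! ### The steps alternate -/

/-- `qₙ ≠ 0` for `n ≥ 2` (real cast). -/
theorem q_cast_ne_zero (n : ℕ) (hn : 2 ≤ n) : (q n : ℝ) ≠ 0 := by
  have := (ratio_bounds n hn).1
  unfold u at this
  intro h; rw [h, mul_zero] at this; exact lt_irrefl _ this

/-- **The steps of `pₙ/qₙ` alternate**: `(-1)^{n+1}(p_{n+1}/q_{n+1} - pₙ/qₙ) = Zₙ/(uₙu_{n+1}) > 0`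
for `n ≥ 2` (`Zₙ > 0`, `uₙ = (-1)^{n+1}qₙ > 0`). -/
theorem signed_step_pos (n : ℕ) (hn : 2 ≤ n) :
    0 < (-1 : ℝ) ^ (n + 1) * ((p (n + 1) : ℝ) / q (n + 1) - (p n : ℝ) / q n) := by
  have hZ := (Z_ratio_bounds n hn).1
  have hu0 := (ratio_bounds n hn).1
  have hu1 := (ratio_bounds (n + 1) (by omega)).1
  have hq0 := q_cast_ne_zero n hn
  have hq1 := q_cast_ne_zero (n + 1) (by omega)
  have e1 : ((-1 : ℝ) ^ (n + 1)) * (-1) ^ (n + 1) = 1 := by rw [← mul_pow]; norm_num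
  -- `s = (qₙp_{n+1} - q_{n+1}pₙ)/(qₙq_{n+1})`, `qₙp_{n+1} - q_{n+1}pₙ = (-1)^n Zₙ`, `qₙq_{n+1} = -uₙu_{n+1}`
  have hs : (p (n + 1) : ℝ) / q (n + 1) - (p n : ℝ) / q n
      = ((q n : ℝ) * p (n + 1) - q (n + 1) * p n) / ((q n : ℝ) * q (n + 1)) := by
    rw [div_sub_div _ _ hq1 hq0]; ring
  have hqq : (q n : ℝ) * q (n + 1) = -(u n * u (n + 1)) := by
    unfold u; rw [pow_succ]; linear_combination (-(q n : ℝ) * q (n + 1)) * e1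
  have hnum : (-1 : ℝ) ^ (n + 1) * ((q n : ℝ) * p (n + 1) - q (n + 1) * p n) = -Z n := by
    rw [Z_eq]; ring
  rw [hs, ← mul_div_assoc, hnum, hqq, neg_div_neg_eq]
  exact div_pos hZ (mul_pos hu0 hu1)

/-- **The steps of `p̃ₙ/qₙ` alternate (the other way)**: `(-1)^n(p̃_{n+1}/q_{n+1} - p̃ₙ/qₙ) > 0` for
`n ≥ 3` (`Ztₙ > 0` with `Ztₙ = (-1)^{n+1}(qₙp̃_{n+1} - q_{n+1}p̃ₙ)`). -/
theorem signed_step_tilde_pos (n : ℕ) (hn : 3 ≤ n) :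
    0 < (-1 : ℝ) ^ n * ((ptilde (n + 1) : ℝ) / q (n + 1) - (ptilde n : ℝ) / q n) := by
  have hZ := (Zt_ratio_bounds n hn).1
  have hu0 := (ratio_bounds n (by omega)).1
  have hu1 := (ratio_bounds (n + 1) (by omega)).1
  have hq0 := q_cast_ne_zero n (by omega)
  have hq1 := q_cast_ne_zero (n + 1) (by omega)
  have e0 : ((-1 : ℝ) ^ n) * (-1) ^ n = 1 := by rw [← mul_pow]; norm_num
  have hs : (ptilde (n + 1) : ℝ) / q (n + 1) - (ptilde n : ℝ) / q n
      = ((q n : ℝ) * ptilde (n + 1) - q (n + 1) * ptilde n) / ((q n : ℝ) * q (n + 1)) := by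
    rw [div_sub_div _ _ hq1 hq0]; ring
  have hqq : (q n : ℝ) * q (n + 1) = -(u n * u (n + 1)) := by
    unfold u; rw [pow_succ, pow_succ]; linear_combination (-(q n : ℝ) * q (n + 1)) * e0
  have hnum : (-1 : ℝ) ^ n * ((q n : ℝ) * ptilde (n + 1) - q (n + 1) * ptilde n) = -Zt n := by
    rw [Zt_eq]; ring
  rw [hs, ← mul_div_assoc, hnum, hqq, neg_div_neg_eq]
  exact div_pos hZ (mul_pos hu0 hu1)

/-! ### Signs of the forms from the identifications -/

variable {L : ℝ}

/-- The `ζ(5)` side, `n ≥ 2`: if `pₙ/qₙ → L` then `(-1)^{n+1}(L - pₙ/qₙ) > 0`. -/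
theorem signed_sub_pos_of_tendsto (hL : Tendsto (fun n : ℕ => (p n : ℝ) / q n) atTop (𝓝 L))
    (n : ℕ) (hn : 2 ≤ n) : 0 < (-1 : ℝ) ^ (n + 1) * (L - (p n : ℝ) / q n) :=
  TailSqueeze.sign_lim_sub (fun n => (p n : ℝ) / q n) 2 (θ := 1045 / 796 ^ 2) (by norm_num)
    (by norm_num) hL step_contraction n hn (abs_neg_one_pow (n + 1)) (signed_step_pos n hn)

/-- **`ℓₙ > 0` from the identification**: if `pₙ/qₙ → L` then `qₙL - pₙ > 0` for every `n ≥ 1`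
(`n ≥ 2`: `qₙ(L - pₙ/qₙ) = uₙ · (-1)^{n+1}(L - pₙ/qₙ)`; `n = 1`: `L - 29/28 ≥ 199/163968 - |L - p₂/q₂|`
and `|L - p₂/q₂| ≤ |p₃/q₃ - p₂/q₂|/(1-θ)`, `|p₃/q₃ - p₂/q₂| = 20567/112978771488`). -/
theorem ell_pos_of_tendsto (hL : Tendsto (fun n : ℕ => (p n : ℝ) / q n) atTop (𝓝 L))
    (n : ℕ) (hn : 1 ≤ n) : 0 < (q n : ℝ) * L - p n := by
  rcases Nat.lt_or_ge n 2 with h | h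
  · obtain rfl : n = 1 := by omega
    have htail : |L - (p 2 : ℝ) / q 2| ≤ |(p 3 : ℝ) / q 3 - (p 2 : ℝ) / q 2| / (1 - 1045 / 796 ^ 2) :=
      TailSqueeze.abs_lim_sub_le (fun n => (p n : ℝ) / q n) 2 (θ := 1045 / 796 ^ 2)
        (by norm_num) (by norm_num) hL step_contraction 2 le_rfl
    have hq1 : q 1 = 42 := rfl
    have hp1 : p 1 = 87 / 2 := rfl
    rw [q_two, q_three, p_two, p_three] at htail
    rw [hq1, hp1]
    push_cast at htail ⊢
    have hb : |L - (-1190161 / 64 : ℝ) / (-17934)| ≤ 1 / 1000000 := by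
      refine htail.trans ?_
      rw [abs_of_nonpos (by norm_num)]
      norm_num
    have hb' := (abs_le.1 hb).1
    norm_num at hb'
    linarith
  · have hs := signed_sub_pos_of_tendsto hL n h
    have hu := (ratio_bounds n h).1
    have hq := q_cast_ne_zero n h
    have h1 : (q n : ℝ) * (L - (p n : ℝ) / q n) = (q n : ℝ) * L - p n := by field_simp
    have e : (q n : ℝ) * L - p n = u n * ((-1 : ℝ) ^ (n + 1) * (L - (p n : ℝ) / q n)) := by
      unfold u
      calc (q n : ℝ) * L - p n = 1 * ((q n : ℝ) * (L - (p n : ℝ) / q n)) := by rw [h1, one_mul]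
        _ = ((-1 : ℝ) ^ (n + 1) * (-1) ^ (n + 1)) * ((q n : ℝ) * (L - (p n : ℝ) / q n)) := by
          rw [← mul_pow]; norm_num
        _ = _ := by ring
    rw [e]
    exact mul_pos hu hs

variable {L' : ℝ}

/-- The `ζ(3)` side, `n ≥ 3`: if `p̃ₙ/qₙ → L'` then `(-1)^n(L' - p̃ₙ/qₙ) > 0`. -/
theorem signed_sub_tilde_pos_of_tendsto
    (hL : Tendsto (fun n : ℕ => (ptilde n : ℝ) / q n) atTop (𝓝 L'))
    (n : ℕ) (hn : 3 ≤ n) : 0 < (-1 : ℝ) ^ n * (L' - (ptilde n : ℝ) / q n) :=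
  TailSqueeze.sign_lim_sub (fun n => (ptilde n : ℝ) / q n) 3 (θ := 1045 / 796 ^ 2) (by norm_num)
    (by norm_num) hL step_tilde_contraction n hn (abs_neg_one_pow n) (signed_step_tilde_pos n hn)

/-- **`ℓ̃ₙ < 0` from the identification**: if `p̃ₙ/qₙ → L'` then `qₙL' - p̃ₙ < 0` for every `n ≥ 1`
(`n ≥ 3` by the tail sign; `n = 1, 2` from the exact steps `p̃₂/q₂ - p̃₁/q₁ = -31/95648`,
`p̃₃/q₃ - p̃₂/q₂ = 128801/2306649917880` and the certified tail `|L' - p̃₃/q₃| ≤ |p̃₄/q₄ - p̃₃/q₃|/(1-θ)`). -/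
theorem ellTilde_neg_of_tendsto (hL : Tendsto (fun n : ℕ => (ptilde n : ℝ) / q n) atTop (𝓝 L'))
    (n : ℕ) (hn : 1 ≤ n) : (q n : ℝ) * L' - ptilde n < 0 := by
  rcases Nat.lt_or_ge n 3 with h | h
  · have htail : |L' - (ptilde 3 : ℝ) / q 3| ≤
        |(ptilde 4 : ℝ) / q 4 - (ptilde 3 : ℝ) / q 3| / (1 - 1045 / 796 ^ 2) :=
      TailSqueeze.abs_lim_sub_le (fun n => (ptilde n : ℝ) / q n) 3
        (θ := 1045 / 796 ^ 2) (by norm_num) (by norm_num) hL step_tilde_contraction 3 le_rfl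
    rw [q_three, q_four, ptilde_three, ptilde_four] at htail
    push_cast at htail
    have hb : |L' - (3710571371 / 216 : ℝ) / 14290980| ≤ 1 / 10 ^ 10 := by
      refine htail.trans ?_
      rw [abs_of_nonpos (by norm_num)]
      norm_num
    have hb1 := (abs_le.1 hb).1
    have hb2 := (abs_le.1 hb).2
    norm_num at hb1 hb2
    have hq1 : q 1 = 42 := rfl
    have hp1 : ptilde 1 = 101 / 2 := rfl
    interval_cases n
    · rw [hq1, hp1]; push_cast; linarith
    · rw [q_two, ptilde_two]; push_cast; linarith
  · have hs := signed_sub_tilde_pos_of_tendsto hL n h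
    have hu := (ratio_bounds n (by omega)).1
    have hq := q_cast_ne_zero n (by omega)
    have h1 : (q n : ℝ) * (L' - (ptilde n : ℝ) / q n) = (q n : ℝ) * L' - ptilde n := by field_simp
    have e : (q n : ℝ) * L' - ptilde n = -(u n * ((-1 : ℝ) ^ n * (L' - (ptilde n : ℝ) / q n))) := by
      unfold u
      calc (q n : ℝ) * L' - ptilde n = 1 * ((q n : ℝ) * (L' - (ptilde n : ℝ) / q n)) := by
            rw [h1, one_mul]
        _ = ((-1 : ℝ) ^ n * (-1) ^ n) * ((q n : ℝ) * (L' - (ptilde n : ℝ) / q n)) := by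
          rw [← mul_pow]; norm_num
        _ = _ := by ring
    rw [e]
    exact neg_neg_of_pos (mul_pos hu hs)

/-- **The signs (3) of Zudilin's Theorem 1 follow from the two identifications**:
`(pₙ/qₙ → ζ(5)) → (p̃ₙ/qₙ → ζ(3)) → theorem1_signs` (`ℓₙ > 0`, `ℓ̃ₙ < 0` for all `n ≥ 1`). -/
theorem theorem1_signs_of_tendsto
    (h5 : Tendsto (fun n : ℕ => (p n : ℝ) / q n) atTop (𝓝 (zetaValue 5)))
    (h3 : Tendsto (fun n : ℕ => (ptilde n : ℝ) / q n) atTop (𝓝 (zetaValue 3))) :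
    theorem1_signs := fun n hn =>
  ⟨by unfold ell; exact ell_pos_of_tendsto h5 n hn,
   by unfold ellTilde; exact ellTilde_neg_of_tendsto h3 n hn⟩

end Zudilin2002Growth

end Summit.KontsevichZagierPeriods.Zeta5Search
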